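import Summits.KontsevichZagierPeriods.KontsevichZagierPeriods.Theorems.IsogenyCertificatesXMapPeriodTransfer
import Summits.KontsevichZagierPeriods.KontsevichZagierPeriods.Theorems.IsogenyCertificatesXMapKernelStubSectorRepsExist
import Summits.KontsevichZagierPeriods.KontsevichZagierPeriods.Theorems.EllipticMomentKernel.Negative.Roots

/-!
# `XMapKernel` (stmt-KontsevichZagierPeriods-10663), line `derived-datum-quasi-periods` — stub `stub_unboundedToEgg`

For an integral cubic `P = x³ + Ax + B` with THREE real roots (`4A³ + 27B² < 0`) the positivity set
`{P > 0}` is the disjoint union of the EGG `E = (e₃, e₂) = {P > 0} ∖ U` and the UNBOUNDED COMPONENT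
`U = (e₁, ∞) = connectedComponentIn {P > 0} (1 + |A| + |B|)`. The stub: there is `k ≥ 1` with

  `[E, s/√P] ∼ [U, (k s/2)/√P]`  (`KZ.Equivalent`) for every `s : ℚ`.

Proof. Take the DUPLICATION datum `(f₂, g₂, 2)` of the curve `y² = P(x)` onto itself
(`XMapPeriodTransferCells.stub_dupDatum`): every cell of its cell locus `L₂ = {P > 0, W₂ ≠ 0}` is
mapped by the x-map injectively onto `U` (`dup_cell_image`, the 2-descent square identity), so the
sibling census `XMapPeriodTransferCells.stub_cellCensus` with source piece `K := E` gives
`[E, s/√P] − [U, (m_U s/|2|)/√P] − [E, 0·…] ∈ KZ.relations`, the last term being itself a relation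
(zero integrand); `k := m_U`. Positivity of `m_U` is read off by SOUNDNESS of the calculus
(`KZ.Equivalent.value_eq_holds`): for `s = 1` the left value is `∫_E dx/√P > 0` (positive integrand on
the non-empty open interval `(e₃, e₂)`, roots from `EllipticMomentKernelNegative.exists_roots`,
`E = (e₃, e₂)` by `stub_cubicComponents`), the right value is `(m_U/2)·∫_U dx/√P`, so `m_U ≠ 0`.
Integrability of `dx/√P` on `{P > 0}` comes from the sector representation
`SectorRepsExist.stub_sectorRepsExist`. No definitions are introduced (all sets written out).

References: M. Kontsevich, D. Zagier, *Periods* (2001), §1.2 (rules (1), (2)); J. H. Silverman,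
*The Arithmetic of Elliptic Curves* (2009), III.4–III.6; S. Basu, R. Pollack, M.-F. Roy,
*Algorithms in Real Algebraic Geometry* (2006), Thm. 5.22.
-/

noncomputable section

open Set Filter MeasureTheory Polynomial Topology
open Literature.NumberTheory.Transcendental
open Literature.ModelTheory.ExponentialFields (IsSemialgebraic)
open Summit.KontsevichZagierPeriods.IsogenyCertificates.XMapPeriodTransferCells
open Summit.KontsevichZagierPeriods.HermiteRigidity.EllipticMomentKernelNegative
  (cubic disc exists_roots cubic_sign_of_roots)

namespace Summit.KontsevichZagierPeriods.IsogenyCertificates.XMapKernelStubs.UnboundedToEgg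

/-! ### The egg of a three-real-root cubic -/

-- adapted from the lead's work file `work/stubs/EngineAux.lean` (`cubic_neg_four`)
/-- The Weierstrass cubic `4x³ − q₂x − q₃` with `q₂ = −4A`, `q₃ = −4B` is `4·(x³ + Ax + B)`. [folklore] -/
private theorem cubic_neg_four' (A B : ℤ) (x : ℝ) :
    cubic (-4 * (A : ℚ)) (-4 * (B : ℚ)) x = 4 * (x ^ 3 + (A : ℝ) * x + (B : ℝ)) := by
  simp only [cubic, Rat.cast_mul, Rat.cast_neg, Rat.cast_ofNat, Rat.cast_intCast]
  ring

-- adapted from the lead's work file `work/stubs/EngineAux.lean` (`egg_geometry`)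
/-- **Egg geometry.** For `4A³ + 27B² < 0` the cubic `x³ + Ax + B` has real roots `e₃ < e₂` with
`{P > 0} ∖ (unbounded component) = (e₃, e₂)`. [folklore] -/
private theorem egg_geometry' (A B : ℤ) (hΔ : 4 * A ^ 3 + 27 * B ^ 2 < 0) :
    ∃ e₃ e₂ : ℝ, e₃ < e₂ ∧
      {y : ℝ | 0 < y ^ 3 + (A : ℝ) * y + (B : ℝ)} \
          connectedComponentIn {y : ℝ | 0 < y ^ 3 + (A : ℝ) * y + (B : ℝ)} (1 + |(A : ℝ)| + |(B : ℝ)|) =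
        Ioo e₃ e₂ := by
  have hdisc : 0 < disc (-4 * (A : ℚ)) (-4 * (B : ℚ)) := by
    have h : ((4 * A ^ 3 + 27 * B ^ 2 : ℤ) : ℝ) < 0 := by exact_mod_cast hΔ
    push_cast at h
    simp only [disc, Rat.cast_mul, Rat.cast_neg, Rat.cast_ofNat, Rat.cast_intCast]
    nlinarith
  obtain ⟨e₃, e₂, e₁, h3, h2a, h2b, h1, hf⟩ := exists_roots hdisc
  have h32 : e₃ < e₂ := by linarith
  have h21 : e₂ < e₁ := by linarith
  have hfac : ∀ x : ℝ, x ^ 3 + (A : ℝ) * x + (B : ℝ) = (x - e₃) * (x - e₂) * (x - e₁) := by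
    intro x
    have h := hf x
    rw [cubic_neg_four'] at h
    linarith
  refine ⟨e₃, e₂, h32, ?_⟩
  obtain ⟨hpos, -⟩ := cubic_sign_of_roots h32 h21 hf
  have he₃ : e₃ ^ 3 + (A : ℝ) * e₃ + (B : ℝ) = 0 := by rw [hfac]; ring
  have he₂ : e₂ ^ 3 + (A : ℝ) * e₂ + (B : ℝ) = 0 := by rw [hfac]; ring
  have hIoo : Ioo e₃ e₂ ⊆ {y : ℝ | 0 < y ^ 3 + (A : ℝ) * y + (B : ℝ)} := by
    intro y hy
    have h := hpos y hy
    rw [cubic_neg_four'] at h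
    simp only [mem_setOf_eq]
    linarith
  exact ((stub_cubicComponents A B hΔ.ne _ rfl e₃ he₃).2 e₂ he₂ h32 hIoo).symm

/-- **The egg period is positive**: `0 < ∫_E dx/√P` for a three-real-root cubic (positive integrand
on the non-empty open interval `E = (e₃, e₂)`). [folklore] -/
private theorem egg_period_pos' (A B : ℤ) (hΔ : 4 * A ^ 3 + 27 * B ^ 2 < 0)
    (hint : IntegrableOn (fun x : Fin 1 → ℝ => 1 / Real.sqrt (x 0 ^ 3 + (A : ℝ) * x 0 + (B : ℝ)))
      {x : Fin 1 → ℝ | 0 < x 0 ^ 3 + (A : ℝ) * x 0 + (B : ℝ)}) :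
    0 < ∫ x in {x : Fin 1 → ℝ | x 0 ∈ {y : ℝ | 0 < y ^ 3 + (A : ℝ) * y + (B : ℝ)} \
      connectedComponentIn {y : ℝ | 0 < y ^ 3 + (A : ℝ) * y + (B : ℝ)} (1 + |(A : ℝ)| + |(B : ℝ)|)},
      1 / Real.sqrt (x 0 ^ 3 + (A : ℝ) * x 0 + (B : ℝ)) := by
  obtain ⟨e₃, e₂, h32, hegg⟩ := egg_geometry' A B hΔ
  rw [hegg]
  have hopen : IsOpen {x : Fin 1 → ℝ | x 0 ∈ Ioo e₃ e₂} := isOpen_Ioo.preimage (continuous_apply 0)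
  have hmeas : MeasurableSet {x : Fin 1 → ℝ | x 0 ∈ Ioo e₃ e₂} := hopen.measurableSet
  have hsubS : {x : Fin 1 → ℝ | x 0 ∈ Ioo e₃ e₂} ⊆
      {x : Fin 1 → ℝ | 0 < x 0 ^ 3 + (A : ℝ) * x 0 + (B : ℝ)} := by
    intro x hx
    have hx' : x 0 ∈ {y : ℝ | 0 < y ^ 3 + (A : ℝ) * y + (B : ℝ)} \
        connectedComponentIn {y : ℝ | 0 < y ^ 3 + (A : ℝ) * y + (B : ℝ)} (1 + |(A : ℝ)| + |(B : ℝ)|) := by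
      rw [hegg]; exact hx
    exact hx'.1
  have hmid : (fun _ : Fin 1 => (e₃ + e₂) / 2) ∈ {x : Fin 1 → ℝ | x 0 ∈ Ioo e₃ e₂} :=
    ⟨by linarith, by linarith⟩
  rw [setIntegral_pos_iff_support_of_nonneg_ae ?_ (hint.mono_set hsubS)]
  · have hsub : {x : Fin 1 → ℝ | x 0 ∈ Ioo e₃ e₂} ⊆
        Function.support (fun x : Fin 1 → ℝ => 1 / Real.sqrt (x 0 ^ 3 + (A : ℝ) * x 0 + (B : ℝ))) ∩
          {x : Fin 1 → ℝ | x 0 ∈ Ioo e₃ e₂} := by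
      intro x hx
      refine ⟨?_, hx⟩
      simp only [Function.mem_support, ne_eq, one_div, inv_eq_zero]
      exact (Real.sqrt_pos.mpr (hsubS hx)).ne'
    exact lt_of_lt_of_le (hopen.measure_pos volume ⟨_, hmid⟩) (measure_mono hsub)
  · filter_upwards [ae_restrict_mem hmeas] with x _
    exact div_nonneg zero_le_one (Real.sqrt_nonneg _)

/-! ### The census of the duplication datum on the egg -/

/-- **Census of the duplication datum on the egg.** With `(f₂, g₂, 2)` the duplication datum of
`y² = x³ + Ax + B` (`4A³ + 27B² ≠ 0`), every cell of the egg `E` is mapped injectively onto the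
unbounded component `U`, so `[E, s/√P] − [U, (k s/2)/√P] ∈ KZ.relations` for the number `k` of cells
of `E` (the sibling `stub_cellCensus` with `K := E`; the egg part has zero integrand, a relation).
[cite: KontsevichZagier2001, §1.2] -/
private theorem egg_census' (A B : ℤ) (hΔ : 4 * A ^ 3 + 27 * B ^ 2 ≠ 0)
    (hint : IntegrableOn (fun x : Fin 1 → ℝ => 1 / Real.sqrt (x 0 ^ 3 + (A : ℝ) * x 0 + (B : ℝ)))
      {x : Fin 1 → ℝ | 0 < x 0 ^ 3 + (A : ℝ) * x 0 + (B : ℝ)}) :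
    ∃ k : ℕ, ∀ (s : ℚ) (ρ : KZ.IntegralRep 1),
      ρ.domain = {x | x 0 ∈ {y : ℝ | 0 < y ^ 3 + (A : ℝ) * y + (B : ℝ)} \
        connectedComponentIn {y : ℝ | 0 < y ^ 3 + (A : ℝ) * y + (B : ℝ)} (1 + |(A : ℝ)| + |(B : ℝ)|)} →
      EqOn ρ.integrand (fun x => (s : ℝ) / Real.sqrt (x 0 ^ 3 + (A : ℝ) * x 0 + (B : ℝ))) ρ.domain →
      ∃ u : KZ.IntegralRep 1,
        u.domain = {x | x 0 ∈ connectedComponentIn {y : ℝ | 0 < y ^ 3 + (A : ℝ) * y + (B : ℝ)}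
          (1 + |(A : ℝ)| + |(B : ℝ)|)} ∧
        EqOn u.integrand (fun x => (((k : ℚ) * s / 2 : ℚ) : ℝ) /
          Real.sqrt (x 0 ^ 3 + (A : ℝ) * x 0 + (B : ℝ))) u.domain ∧
        KZ.of ρ - KZ.of u ∈ KZ.relations := by
  obtain ⟨-, -, -, -, hsaE, -, -⟩ := stub_cellsBasic
  set S : Set ℝ := {y : ℝ | 0 < y ^ 3 + (A : ℝ) * y + (B : ℝ)} with hS
  set U : Set ℝ := connectedComponentIn S (1 + |(A : ℝ)| + |(B : ℝ)|) with hU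
  set E : Set ℝ := S \ U with hE
  -- the duplication datum
  set f₂ : ℚ[X] := X ^ 4 - C (2 * (A : ℚ)) * X ^ 2 - C (8 * (B : ℚ)) * X + C ((A : ℚ) ^ 2) with hf₂
  set g₂ : ℚ[X] := C 4 * (X ^ 3 + C (A : ℚ) * X + C (B : ℚ)) with hg₂
  obtain ⟨hW₂, hI₂, -, -⟩ := stub_dupDatum A B f₂ g₂ hf₂ hg₂
  set R₂ : ℝ → ℝ := fun y => aeval y f₂ / aeval y g₂ with hR₂
  set W₂ : ℝ → ℝ := fun y => aeval y (derivative f₂ * g₂ - f₂ * derivative g₂) with hW₂d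
  set L₂ : Set ℝ := {y : ℝ | 0 < y ^ 3 + (A : ℝ) * y + (B : ℝ) ∧
    aeval y (derivative f₂ * g₂ - f₂ * derivative g₂) ≠ 0} with hL₂
  have hL₂' : L₂ = {y : ℝ | 0 < y ^ 3 + (A : ℝ) * y + (B : ℝ) ∧ W₂ y ≠ 0} := by rw [hL₂]
  have hES : E ⊆ S := Set.sdiff_subset
  -- the census with source piece `K := E`
  obtain ⟨kU, kE, hkE, hc⟩ := stub_cellCensus A B A B f₂ g₂ 2 hW₂ hI₂ R₂ W₂ L₂ hR₂ hW₂d hL₂'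
    U E hU hE E hES (hsaE A B)
    (fun x₀ hx₀ hK => cell_subset_egg A B f₂ g₂ hx₀ hK)
    (fun x₀ hx₀ _ => by
      obtain ⟨hinj, himg⟩ := dup_cell_image A B hΔ f₂ g₂ hf₂ hg₂ hx₀
      exact ⟨hinj, Or.inl himg⟩)
    (fun x₀ hx₀ _ => stub_cellMove A B A B f₂ g₂ 2 hW₂ hI₂ R₂ W₂ L₂ hR₂ hW₂d hL₂' x₀ hx₀
      (dup_cell_image A B hΔ f₂ g₂ hf₂ hg₂ hx₀).1)
    hint
  have hkE0 : kE = 0 := hkE fun x₀ hx₀ _ => (dup_cell_image A B hΔ f₂ g₂ hf₂ hg₂ hx₀).2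
  refine ⟨kU, fun s ρ hρd hρe => ?_⟩
  obtain ⟨u, e, hud, hue, -, hee, hrel⟩ := hc s ρ hρd hρe
  have he0 : KZ.of e ∈ KZ.relations := by
    refine KZ.of_mem_relations_of_eqOn_zero e fun x hx => ?_
    rw [hee hx, hkE0]
    simp
  refine ⟨u, hud, fun x hx => ?_, ?_⟩
  · rw [hue hx, abs_two]
  · have : KZ.of ρ - KZ.of u = (KZ.of ρ - KZ.of u - KZ.of e) + KZ.of e := by abel
    rw [this]
    exact KZ.relations.add_mem hrel he0

/-! ### The stub -/

/-- **Registered stub `stub_unboundedToEgg`** of the line `derived-datum-quasi-periods`: for a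
three-real-root integral cubic `P = x³ + Ax + B` there is `k ≥ 1` with `[E, s/√P] ∼ [U, (k s/2)/√P]`
for every `s : ℚ`, `E` the egg and `U` the unbounded component of `{P > 0}` — the census of the
duplication datum on the egg (`k` = its number of cells, positive by soundness and `∫_E dx/√P > 0`).
[cite: KontsevichZagier2001, §1.2] -/
theorem stub_unboundedToEgg : ∀ (A B : ℤ), 4 * A ^ 3 + 27 * B ^ 2 < 0 → ∃ k : ℕ, 0 < k ∧ ∀ (s : ℚ) (e u : Literature.NumberTheory.Transcendental.KZ.IntegralRep 1), e.domain = {x | x 0 ∈ {y : ℝ | 0 < y ^ 3 + (A : ℝ) * y + (B : ℝ)} \ connectedComponentIn {y : ℝ | 0 < y ^ 3 + (A : ℝ) * y + (B : ℝ)} (1 + |(A : ℝ)| + |(B : ℝ)|)} → Set.EqOn e.integrand (fun x => (s : ℝ) / Real.sqrt (x 0 ^ 3 + (A : ℝ) * x 0 + (B : ℝ))) e.domain → u.domain = {x | x 0 ∈ connectedComponentIn {y : ℝ | 0 < y ^ 3 + (A : ℝ) * y + (B : ℝ)} (1 + |(A : ℝ)| + |(B : ℝ)|)} → Set.EqOn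 u.integrand (fun x => (((k : ℚ) * s / 2 : ℚ) : ℝ) / Real.sqrt (x 0 ^ 3 + (A : ℝ) * x 0 + (B : ℝ))) u.domain → Literature.NumberTheory.Transcendental.KZ.Equivalent e u := by
  intro A B hΔ
  have hΔ0 : 4 * A ^ 3 + 27 * B ^ 2 ≠ 0 := hΔ.ne
  obtain ⟨-, -, -, -, hsaE, -, -⟩ := stub_cellsBasic
  -- integrability of `dx/√P` on `{P > 0}`, from the sector representation
  obtain ⟨r₁, hr₁d, hr₁i⟩ := SectorRepsExist.stub_sectorRepsExist A B 1 hΔ0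
  have hint : IntegrableOn (fun x : Fin 1 → ℝ => 1 / Real.sqrt (x 0 ^ 3 + (A : ℝ) * x 0 + (B : ℝ)))
      {x : Fin 1 → ℝ | 0 < x 0 ^ 3 + (A : ℝ) * x 0 + (B : ℝ)} :=
    XMapPeriodTransferValue.integrableOn_of_rep (a := 1) r₁ hr₁d
      (by rw [hr₁i]; exact fun _ _ => rfl) one_ne_zero
  obtain ⟨k, hk⟩ := egg_census' A B hΔ0 hint
  have hES : {x : Fin 1 → ℝ | x 0 ∈ {y : ℝ | 0 < y ^ 3 + (A : ℝ) * y + (B : ℝ)} \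
      connectedComponentIn {y : ℝ | 0 < y ^ 3 + (A : ℝ) * y + (B : ℝ)} (1 + |(A : ℝ)| + |(B : ℝ)|)} ⊆
      {x : Fin 1 → ℝ | 0 < x 0 ^ 3 + (A : ℝ) * x 0 + (B : ℝ)} := fun x hx => hx.1
  -- `0 < k` by soundness: `∫_E dx/√P = (k/2) ∫_U dx/√P` and the egg period is positive
  have hk0 : 0 < k := by
    obtain ⟨ρ, hρd, hρi⟩ := exists_rep A B 1 (hsaE A B) hES hint
    obtain ⟨u, hud, hue, hrel⟩ := hk 1 ρ hρd (by rw [hρi]; exact fun _ _ => rfl)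
    have hv : ρ.value = u.value := KZ.Equivalent.value_eq_holds hrel
    rw [value_rep (A := A) (B := B) (s := 1) ρ hρd (by rw [hρi]; exact fun _ _ => rfl),
      value_rep (A := A) (B := B) u hud hue] at hv
    have hΩE := egg_period_pos' A B hΔ hint
    refine Nat.pos_of_ne_zero fun h0 => ?_
    rw [h0] at hv
    simp only [Nat.cast_zero, zero_mul, zero_div, Rat.cast_zero, Rat.cast_one, one_mul] at hv
    exact hΩE.ne' hv
  refine ⟨k, hk0, fun s e u hed hee hud hue => ?_⟩
  obtain ⟨u₁, hu₁d, hu₁e, hrel₁⟩ := hk s e hed hee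
  have h₁ : KZ.Equivalent u₁ u :=
    XMapPeriodTransferValue.equivalent_of_eqOn u₁ u (hud.trans hu₁d.symm) fun x hx => by
      have hx' : x ∈ u.domain := by rw [hud, ← hu₁d]; exact hx
      rw [hu₁e hx, hue hx']
  exact KZ.Equivalent.trans hrel₁ h₁

end Summit.KontsevichZagierPeriods.IsogenyCertificates.XMapKernelStubs.UnboundedToEgg

end
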